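import Summits.ResolutionOfSingularities.ResolutionOfSingularities.Theorems.EquisingularLiftCampaignW45bBlowupChartPresentation
import Literature.AlgebraicGeometry.Resolution.AdicCompletionRegular
import HarnessLib

/-!
# [OURS · L1 W4.5(b)] L2 — UNIQUE BAD POINT: the blow-up of a non-regular lci trace `V(e, w)` has exactly one non-regular point over the closed point

Crux chain w45b, working crux EL♮ = `Theses.EquisingularLift.EquisingularLiftNat` (stmt-ResolutionOfSingularities-20038), research
stub `stub_elnat_three`; helper L2 of CRUX-PLAN v1.1 §3.4 (res-L1-w45b-plan-1) — companion of AVOID-L1 (`…AvoidBadPoint.lean`):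
«the localisation of `Bl_{(e,w)} R` at every point over `𝔪` other than `𝔓₀ := (𝔪, w/e)` of the chart `w = T′e` is regular, and at
`𝔓₀` it is not (`eT′ − w ∈ 𝔑²`)». OURS; NOT a statement of any manuscript; AI-written, weaker than expert review.
`--supports stmt-ResolutionOfSingularities-20038 --as helper`.

SETTING (downstairs, CRUX-PLAN v3 §1.1): `R` regular local (any dimension), `e ∈ 𝔪 ∖ 𝔪²`, `w ∈ 𝔪²`, `w ∉ (e)`: `Z = V(e, w)` is the
special-fibre trace of a Δ-centre or a comb. The two charts of `Bl_Z` are the hypersurfaces `R[Z/e] = R[X]/(eX − w)` and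
`R[Z/w] = R[X]/(wX − e)` (`…BlowupChartPresentation.lean`); their points over the closed point `q` of `R` with RATIONAL coordinate
(all closed points of the exceptional curve `ℙ¹_k` when `k = R/𝔪` is algebraically closed) are `(𝔪, w/e − c)` and `(𝔪, e/w − c)`,
`c ∈ R`. In the regular local ring `R[X]_Q` (Serre + Hilbert: `R[X]` is a regular ring) the criterion is «`f ∉ 𝔑_Q²`» (Matsumura 14.2):

* `not_isRegularLocalRing_localization_of_mem_sq` / **`not_isRegularLocalRing_localization_badPoint`** — at `𝔓₀ = (𝔪, w/e)`:
  `eX − w ∈ (𝔪, X)²`, so `Bl_Z` is NOT regular at the bad point (no section of the ambient passes through it);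
* `isRegularLocalRing_localization_of_eval_notMem_sq` / **`isRegularLocalRing_localization_of_gen_sub_unit_mem`** — at
  `(𝔪, w/e − c)`, `c` a unit: `eX − w ≡ ec − w ∉ 𝔪²`, so `Bl_Z` IS regular there;
* **`isRegularLocalRing_localization_wChart`** — at every point `(𝔪, e/w − c)` of the `w`-chart, any `c`: `wX − e ≡ wc − e ∉ 𝔪²`,
  regular.
Hence `𝔓₀` is the UNIQUE non-regular point of `Bl_Z` over `q` among its rational points; AVOID-L1 makes the strict transform of an
equimultiple hypersurface miss it, so all its new points over `q` are good points (sections exist: T_sec p497593) and the E1 game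
continues. Auxiliary: `ker_residue_comp_evalRingHom_*` (the point `(𝔪, X − c)` of `R[X]`).

References: res-L1-w45b-plan-1 CRUX-PLAN v1.1 §3.4 L2, v3 §1.1/§1.7 (OURS); H. Matsumura, *Commutative Ring Theory*, Thm. 14.2,
19.3; Q. Liu (2002) §8.1 — context only.
-/

noncomputable section

set_option linter.dupNamespace false -- mandated namespace `Summit.<Summit>.<Problem>` of this single-conjunct summit

open IsLocalRing IsLocalization Polynomial
open Literature.AlgebraicGeometry.Resolution

namespace Summit.ResolutionOfSingularities.ResolutionOfSingularities.Cruxes.EquisingularLiftNat.Sections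

universe u

/-! ## The rational point `(𝔪, X − c)` of `R[X]` over the closed point of a local ring `R` -/

section EvalPoint

variable {R : Type u} [CommRing R] [IsLocalRing R] (c : R)

/-- The evaluation `R[X] → R/𝔪`, `X ↦ c̄`, is surjective. [folklore] -/
theorem residue_comp_evalRingHom_surjective :
    Function.Surjective ((residue R).comp (Polynomial.evalRingHom c)) := by
  intro x
  obtain ⟨r, rfl⟩ := residue_surjective x
  exact ⟨C r, by simp⟩

/-- Its kernel `(𝔪, X − c)` is a maximal ideal of `R[X]`. [folklore] -/
theorem ker_residue_comp_evalRingHom_isMaximal :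
    (RingHom.ker ((residue R).comp (Polynomial.evalRingHom c))).IsMaximal :=
  RingHom.ker_isMaximal_of_surjective _ (residue_comp_evalRingHom_surjective c)

/-- Membership in `(𝔪, X − c)`: `p(c) ∈ 𝔪`. [folklore] -/
theorem mem_ker_residue_comp_evalRingHom_iff (p : R[X]) :
    p ∈ RingHom.ker ((residue R).comp (Polynomial.evalRingHom c)) ↔ p.eval c ∈ maximalIdeal R := by
  rw [RingHom.mem_ker, RingHom.comp_apply, Polynomial.coe_evalRingHom, residue_eq_zero_iff]

/-- `(𝔪, X − c)` is contained in every ideal containing `𝔪 R[X]` and `X − c` (Euclidean division by `X − c`). [folklore] -/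
theorem ker_residue_comp_evalRingHom_le {Q : Ideal R[X]} (hm : (maximalIdeal R).map (C : R →+* R[X]) ≤ Q)
    (hc : X - C c ∈ Q) : RingHom.ker ((residue R).comp (Polynomial.evalRingHom c)) ≤ Q := by
  intro p hp
  rw [mem_ker_residue_comp_evalRingHom_iff] at hp
  obtain ⟨g, hg⟩ := Polynomial.X_sub_C_dvd_sub_C_eval (p := p) (a := c)
  have h : p = (X - C c) * g + C (p.eval c) := by rw [← hg]; ring
  rw [h]
  exact Q.add_mem (Q.mul_mem_right _ hc) (hm (Ideal.mem_map_of_mem _ hp))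

/-- A proper ideal containing `𝔪 R[X]` and `X − c` IS the point `(𝔪, X − c)`. [folklore] -/
theorem eq_ker_residue_comp_evalRingHom {Q : Ideal R[X]} (hQ : Q ≠ ⊤)
    (hm : (maximalIdeal R).map (C : R →+* R[X]) ≤ Q) (hc : X - C c ∈ Q) :
    Q = RingHom.ker ((residue R).comp (Polynomial.evalRingHom c)) :=
  ((ker_residue_comp_evalRingHom_isMaximal c).eq_of_le hQ (ker_residue_comp_evalRingHom_le c hm hc)).symm

end EvalPoint

/-! ## The two engines: `f ∈ 𝔑²` (not regular) and `f ∉ 𝔑²` (regular) in `R[X]_Q/(f)`, `f = aX − b` -/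

section Engines

variable {R : Type u} [CommRing R] [IsRegularLocalRing R] {a b : R}

/-- `R[X]_Q` is a regular local ring for every prime `Q` (Serre: `R` is a regular RING; Hilbert: so is `R[X]`).
[cite-free plumbing; folklore] -/
theorem isRegularLocalRing_localization_polynomial (Q : Ideal R[X]) [Q.IsPrime] :
    IsRegularLocalRing (Localization.AtPrime Q) := by
  haveI : IsRegularRing R := isRegularRing_of_isRegularLocalRing R
  infer_instance

/-- The preimage `Q ⊆ R[X]` of a prime `𝔔` of the chart `R[I/a]` under `X ↦ b/a` contains `𝔪 R[X]` as soon as `𝔔` lies over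
`𝔪`. [folklore] -/
theorem map_C_le_comap_aeval_gen (I : Ideal R) (hb : b ∈ I) (𝔔 : Ideal (blowupAlgebra I a))
    (hm : (maximalIdeal R).map (algebraMap R (blowupAlgebra I a)) ≤ 𝔔) :
    (maximalIdeal R).map (C : R →+* R[X]) ≤
      Ideal.comap (Polynomial.aeval (R := R) (blowupAlgebra.gen I a b hb)) 𝔔 := by
  rw [Ideal.map_le_iff_le_comap]
  intro m hmm
  rw [Ideal.mem_comap, Ideal.mem_comap, Polynomial.aeval_C]
  exact hm (Ideal.mem_map_of_mem _ hmm)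

/-- **ENGINE 1 (not regular).** `R` regular local, `I = (a, b)` with `a ∈ 𝔪`, `a ≠ 0`, `a ∣ b x ⇒ a ∣ x`, and `b ∈ 𝔪²`: at a prime
`𝔔 ⊇ 𝔪 R[I/a] + (b/a)` of the chart, `R[I/a]_𝔔 ≅ R[X]_Q/(aX − b)` with `aX − b ∈ (𝔪, X)² ⊆ 𝔑_Q²`, hence NOT regular
(Matsumura 14.2). [folklore] -/
theorem not_isRegularLocalRing_localization_of_mem_sq (I : Ideal R) (hI : I = Ideal.span {a, b}) (hb : b ∈ I)
    (ha : a ∈ maximalIdeal R) (ha0 : a ≠ 0) (hab : ∀ x : R, a ∣ b * x → a ∣ x) (hb2 : b ∈ maximalIdeal R ^ 2)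
    (𝔔 : Ideal (blowupAlgebra I a)) [𝔔.IsPrime]
    (hm : (maximalIdeal R).map (algebraMap R (blowupAlgebra I a)) ≤ 𝔔)
    (ht : blowupAlgebra.gen I a b hb ∈ 𝔔) : ¬ IsRegularLocalRing (Localization.AtPrime 𝔔) := by
  haveI := isDomain_of_isRegularLocalRing R
  set t := blowupAlgebra.gen I a b hb
  set Q : Ideal R[X] := Ideal.comap (Polynomial.aeval (R := R) t) 𝔔 with hQ
  haveI : Q.IsPrime := Ideal.comap_isPrime _ 𝔔
  rw [isRegularLocalRing_localization_iff_chart I hI hb ha0 hab 𝔔 Q hQ]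
  haveI := isRegularLocalRing_localization_polynomial Q
  -- `f = aX − b ∈ Q²`
  have hXQ : (X : R[X]) ∈ Q := by rw [hQ, Ideal.mem_comap, Polynomial.aeval_X]; exact ht
  have hmQ : (maximalIdeal R).map (C : R →+* R[X]) ≤ Q := map_C_le_comap_aeval_gen I hb 𝔔 hm
  have hfQ2 : C a * X - C b ∈ Q ^ 2 := by
    refine Ideal.sub_mem _ ?_ ?_
    · rw [pow_two]; exact Ideal.mul_mem_mul (hmQ (Ideal.mem_map_of_mem _ ha)) hXQ
    · have h : C b ∈ ((maximalIdeal R).map (C : R →+* R[X])) ^ 2 := by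
        rw [← Ideal.map_pow]; exact Ideal.mem_map_of_mem _ hb2
      exact Ideal.pow_right_mono hmQ 2 h
  have hf𝔑 : algebraMap R[X] (Localization.AtPrime Q) (C a * X - C b) ∈
      maximalIdeal (Localization.AtPrime Q) ^ 2 := by
    rw [← Localization.AtPrime.map_eq_maximalIdeal, ← Ideal.map_pow]
    exact Ideal.mem_map_of_mem _ hfQ2
  -- `f ≠ 0` in the domain `R[X]_Q`
  have hf0 : algebraMap R[X] (Localization.AtPrime Q) (C a * X - C b) ≠ 0 := by
    intro h
    have hinj := IsLocalization.injective (Localization.AtPrime Q) Q.primeCompl_le_nonZeroDivisors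
    have h' : C a * X - C b = 0 := hinj (by rw [h, map_zero])
    have h1 := congrArg (fun p : R[X] => p.coeff 1) h'
    simp only [coeff_sub, coeff_C_mul, coeff_X_one, mul_one, coeff_C, one_ne_zero, if_false, sub_zero,
      coeff_zero] at h1
    exact ha0 h1
  exact not_isRegularLocalRing_quotient_span_singleton_of_mem_sq hf0 hf𝔑

/-- **ENGINE 2 (regular).** `R` regular local, `I = (a, b)`, `a ≠ 0`, `a ∣ b x ⇒ a ∣ x`, and `c ∈ R` with `ac − b ∈ 𝔪 ∖ 𝔪²`: at a
prime `𝔔 ⊇ 𝔪 R[I/a] + (b/a − c)` of the chart, `R[I/a]_𝔔 ≅ R[X]_Q/(aX − b)` with `Q = (𝔪, X − c)` and `aX − b ≡ ac − b ∉ 𝔑_Q²`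
(evaluate at `c`), hence REGULAR (Matsumura 14.2). [folklore] -/
theorem isRegularLocalRing_localization_of_eval_notMem_sq (I : Ideal R) (hI : I = Ideal.span {a, b}) (hb : b ∈ I)
    (ha0 : a ≠ 0) (hab : ∀ x : R, a ∣ b * x → a ∣ x) (c : R) (hc1 : a * c - b ∈ maximalIdeal R)
    (hc2 : a * c - b ∉ maximalIdeal R ^ 2) (𝔔 : Ideal (blowupAlgebra I a)) [𝔔.IsPrime]
    (hm : (maximalIdeal R).map (algebraMap R (blowupAlgebra I a)) ≤ 𝔔)
    (hc : blowupAlgebra.gen I a b hb - algebraMap R (blowupAlgebra I a) c ∈ 𝔔) :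
    IsRegularLocalRing (Localization.AtPrime 𝔔) := by
  haveI := isDomain_of_isRegularLocalRing R
  set t := blowupAlgebra.gen I a b hb
  set Q : Ideal R[X] := Ideal.comap (Polynomial.aeval (R := R) t) 𝔔 with hQ
  haveI hQp : Q.IsPrime := Ideal.comap_isPrime _ 𝔔
  rw [isRegularLocalRing_localization_iff_chart I hI hb ha0 hab 𝔔 Q hQ]
  haveI := isRegularLocalRing_localization_polynomial Q
  -- `Q = (𝔪, X − c)`
  have hmQ : (maximalIdeal R).map (C : R →+* R[X]) ≤ Q := map_C_le_comap_aeval_gen I hb 𝔔 hm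
  have hcQ : X - C c ∈ Q := by
    rw [hQ, Ideal.mem_comap, map_sub, Polynomial.aeval_X, Polynomial.aeval_C]; exact hc
  have hQeq : Q = RingHom.ker ((residue R).comp (Polynomial.evalRingHom c)) :=
    eq_ker_residue_comp_evalRingHom c hQp.ne_top hmQ hcQ
  have hevQ : ∀ q ∈ Q, q.eval c ∈ maximalIdeal R := fun q hq => by
    rw [hQeq, mem_ker_residue_comp_evalRingHom_iff] at hq; exact hq
  have hevf : (C a * X - C b).eval c = a * c - b := by
    simp only [eval_sub, eval_mul, eval_C, eval_X]
  -- `f ∈ 𝔑_Q`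
  have hfQ : C a * X - C b ∈ Q := by
    rw [hQeq, mem_ker_residue_comp_evalRingHom_iff, hevf]; exact hc1
  have hf𝔑 : algebraMap R[X] (Localization.AtPrime Q) (C a * X - C b) ∈ maximalIdeal (Localization.AtPrime Q) := by
    rw [← Localization.AtPrime.map_eq_maximalIdeal]; exact Ideal.mem_map_of_mem _ hfQ
  -- `f ∉ 𝔑_Q²`: otherwise `f s ∈ Q²` for some `s ∉ Q`, and evaluating at `c` puts `ac − b` in `𝔪²`
  have hf𝔑2 : algebraMap R[X] (Localization.AtPrime Q) (C a * X - C b) ∉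
      maximalIdeal (Localization.AtPrime Q) ^ 2 := by
    intro h
    rw [← Localization.AtPrime.map_eq_maximalIdeal, ← Ideal.map_pow,
      IsLocalization.mem_map_algebraMap_iff Q.primeCompl] at h
    obtain ⟨⟨⟨i, hi⟩, ⟨s, hs⟩⟩, hx⟩ := h
    have hinj := IsLocalization.injective (Localization.AtPrime Q) Q.primeCompl_le_nonZeroDivisors
    have heq : (C a * X - C b) * s = i := hinj (by rw [map_mul]; exact hx)
    have hev : (a * c - b) * s.eval c = i.eval c := by
      rw [← hevf, ← eval_mul, heq]
    have hi' : i.eval c ∈ maximalIdeal R ^ 2 := by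
      have hle : (Q ^ 2).map (Polynomial.evalRingHom c) ≤ maximalIdeal R ^ 2 := by
        rw [Ideal.map_pow]
        refine Ideal.pow_right_mono ?_ 2
        rw [Ideal.map_le_iff_le_comap]
        intro q hq
        exact hevQ q hq
      exact hle (Ideal.mem_map_of_mem _ hi)
    have hsu : IsUnit (s.eval c) := by
      by_contra hns
      apply hs
      show s ∈ Q
      rw [hQeq, mem_ker_residue_comp_evalRingHom_iff]
      exact (mem_maximalIdeal _).mpr hns
    apply hc2
    have h2 : a * c - b = i.eval c * hsu.unit⁻¹ := by
      rw [← hev, mul_assoc, IsUnit.mul_val_inv, mul_one]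
    rw [h2]
    exact Ideal.mul_mem_right _ _ hi'
  exact (IsRegularLocalRing.quotient_span_singleton hf𝔑 hf𝔑2).1

end Engines

/-! ## L2 for the trace `Z = V(e, w)`: `e` a regular parameter, `w ∈ 𝔪² ∖ (e)` -/

section UniqueBadPoint

variable {R : Type u} [CommRing R] [IsRegularLocalRing R] {e w : R}

/-- `e ∣ w x ⇒ e ∣ x` for a prime `e` not dividing `w`. [folklore] -/
theorem dvd_of_prime_dvd_mul_of_not_dvd {R : Type u} [CommRing R] {e w : R} (hprime : Prime e)
    (hwe : w ∉ Ideal.span {e}) (x : R) (h : e ∣ w * x) : e ∣ x :=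
  (hprime.dvd_or_dvd h).resolve_left fun h' => hwe (Ideal.mem_span_singleton.mpr h')

/-- `w ∣ e x ⇒ w ∣ x` for a prime `e` not dividing `w`, in a domain (`e x = w s ⇒ e ∣ s`, cancel `e`). [folklore] -/
theorem dvd_of_dvd_prime_mul_of_not_dvd {R : Type u} [CommRing R] [IsDomain R] {e w : R} (hprime : Prime e)
    (hwe : w ∉ Ideal.span {e}) (x : R) (h : w ∣ e * x) : w ∣ x := by
  obtain ⟨s, hs⟩ := h
  have hes : e ∣ w * s := ⟨x, by rw [← hs, mul_comm]⟩
  obtain ⟨s', rfl⟩ := dvd_of_prime_dvd_mul_of_not_dvd hprime hwe s hes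
  refine ⟨s', mul_left_cancel₀ hprime.ne_zero ?_⟩
  rw [hs]; ring

/-- **L2 (i) — THE BAD POINT IS BAD.** `R` regular local, `e ∈ 𝔪 ∖ 𝔪²`, `w ∈ 𝔪²`, `w ∉ (e)`: the `e`-chart `R[Z/e]` of the blow-up
of `Z = V(e, w)` is NOT regular at any prime containing `𝔪` and `w/e` — i.e. at the bad point `𝔓₀ = (𝔪, w/e)` (which is maximal,
`badPoint_isMaximal`): `eX − w ∈ 𝔑²`. No section of a smooth ambient passes through the corresponding point. [folklore;
CRUX-PLAN v1.1 §3.4 L2] -/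
theorem not_isRegularLocalRing_localization_badPoint (he : e ∈ maximalIdeal R) (he₂ : e ∉ maximalIdeal R ^ 2)
    (hw : w ∈ maximalIdeal R ^ 2) (hwe : w ∉ Ideal.span {e})
    (𝔔 : Ideal (blowupAlgebra (Ideal.span {e, w}) e)) [𝔔.IsPrime]
    (hm : (maximalIdeal R).map (algebraMap R (blowupAlgebra (Ideal.span {e, w}) e)) ≤ 𝔔)
    (ht : blowupAlgebra.gen (Ideal.span {e, w}) e w (mem_span_pair_right e w) ∈ 𝔔) :
    ¬ IsRegularLocalRing (Localization.AtPrime 𝔔) := by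
  have hprime : Prime e := IsRegularLocalRing.prime_of_not_mem_sq he he₂
  exact not_isRegularLocalRing_localization_of_mem_sq (Ideal.span {e, w}) rfl _ he hprime.ne_zero
    (dvd_of_prime_dvd_mul_of_not_dvd hprime hwe) hw 𝔔 hm ht

/-- **L2 (ii) — THE OTHER RATIONAL POINTS OF THE `e`-CHART ARE GOOD.** Same `R, e, w`: at every prime of `R[Z/e]` containing `𝔪`
and `w/e − c` with `c` a UNIT of `R` (the rational points `t = c̄ ≠ 0` of the exceptional line), the chart IS regular:
`eX − w ≡ ec − w ∉ 𝔪²` modulo `𝔑²`. [folklore; CRUX-PLAN v1.1 §3.4 L2] -/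
theorem isRegularLocalRing_localization_of_gen_sub_unit_mem (he : e ∈ maximalIdeal R) (he₂ : e ∉ maximalIdeal R ^ 2)
    (hw : w ∈ maximalIdeal R ^ 2) (hwe : w ∉ Ideal.span {e}) (c : R) (hc : IsUnit c)
    (𝔔 : Ideal (blowupAlgebra (Ideal.span {e, w}) e)) [𝔔.IsPrime]
    (hm : (maximalIdeal R).map (algebraMap R (blowupAlgebra (Ideal.span {e, w}) e)) ≤ 𝔔)
    (ht : blowupAlgebra.gen (Ideal.span {e, w}) e w (mem_span_pair_right e w) -
      algebraMap R (blowupAlgebra (Ideal.span {e, w}) e) c ∈ 𝔔) :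
    IsRegularLocalRing (Localization.AtPrime 𝔔) := by
  have hprime : Prime e := IsRegularLocalRing.prime_of_not_mem_sq he he₂
  have hw₁ : w ∈ maximalIdeal R := Ideal.pow_le_self two_ne_zero hw
  refine isRegularLocalRing_localization_of_eval_notMem_sq (Ideal.span {e, w}) rfl _ hprime.ne_zero
    (dvd_of_prime_dvd_mul_of_not_dvd hprime hwe) c (Ideal.sub_mem _ (Ideal.mul_mem_right _ _ he) hw₁) ?_ 𝔔 hm ht
  intro h
  apply he₂
  have h1 : e * c ∈ maximalIdeal R ^ 2 := by
    have := Ideal.add_mem _ h hw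
    rwa [sub_add_cancel] at this
  have h2 : e = e * c * hc.unit⁻¹ := by rw [mul_assoc, IsUnit.mul_val_inv, mul_one]
  rw [h2]
  exact Ideal.mul_mem_right _ _ h1

/-- **L2 (iii) — THE `w`-CHART IS GOOD OVER THE CLOSED POINT.** Same `R, e, w`: at every prime of the other chart `R[Z/w]`
(generator `e/w`) containing `𝔪` and `e/w − c`, ANY `c ∈ R` (in particular the origin `c = 0`, the one point of the exceptional
line not in the `e`-chart), the chart IS regular: `wX − e ≡ wc − e ∉ 𝔪²`. Together with (i)/(ii): the bad point `𝔓₀` is the UNIQUE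
non-regular rational point of `Bl_Z` over the closed point. [folklore; CRUX-PLAN v1.1 §3.4 L2] -/
theorem isRegularLocalRing_localization_wChart (he : e ∈ maximalIdeal R) (he₂ : e ∉ maximalIdeal R ^ 2)
    (hw : w ∈ maximalIdeal R ^ 2) (hwe : w ∉ Ideal.span {e}) (c : R)
    (𝔔 : Ideal (blowupAlgebra (Ideal.span {e, w}) w)) [𝔔.IsPrime]
    (hm : (maximalIdeal R).map (algebraMap R (blowupAlgebra (Ideal.span {e, w}) w)) ≤ 𝔔)
    (ht : blowupAlgebra.gen (Ideal.span {e, w}) w e (Ideal.subset_span (by simp)) -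
      algebraMap R (blowupAlgebra (Ideal.span {e, w}) w) c ∈ 𝔔) :
    IsRegularLocalRing (Localization.AtPrime 𝔔) := by
  haveI := isDomain_of_isRegularLocalRing R
  have hprime : Prime e := IsRegularLocalRing.prime_of_not_mem_sq he he₂
  have hw₁ : w ∈ maximalIdeal R := Ideal.pow_le_self two_ne_zero hw
  have hw0 : w ≠ 0 := by rintro rfl; exact hwe (Ideal.zero_mem _)
  have hI : Ideal.span {e, w} = Ideal.span ({w, e} : Set R) := by rw [Set.pair_comm]
  refine isRegularLocalRing_localization_of_eval_notMem_sq (Ideal.span {e, w}) hI _ hw0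
    (dvd_of_dvd_prime_mul_of_not_dvd hprime hwe) c (Ideal.sub_mem _ (Ideal.mul_mem_right _ _ hw₁) he) ?_ 𝔔 hm ht
  intro h
  apply he₂
  have h1 : w * c - (w * c - e) ∈ maximalIdeal R ^ 2 :=
    Ideal.sub_mem _ (Ideal.mul_mem_right _ _ hw) h
  rwa [sub_sub_cancel] at h1

end UniqueBadPoint

end Summit.ResolutionOfSingularities.ResolutionOfSingularities.Cruxes.EquisingularLiftNat.Sections

end
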